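import Literature.Claims.NS.AbuGhuwaleh2026b

/-!
# C61b `AbuGhuwaleh2026b` — kernel kill of Theorem 4.2 (24)–(25): the directional-compression count

Source: M. Abu-Ghuwaleh, «Global Regularity for the Three-Dimensional Periodic Navier–Stokes Equations via
Exact Shell Closure and Directional Compression», Zenodo 10.5281/zenodo.19559087 (2026, 61 pp.; PDF page =
printed page) [cite: AbuGhuwaleh2026b]. Skeleton of record `Literature/Claims/NS/AbuGhuwaleh2026b.lean`
(p494251, typist-6 g3; Steps in dependency order `Step1_Thm42_23` (23) → `Step2_Thm42_2425` /
`Step2L_Thm42_25a` (24)–(25) → `Step3_Thm42_26` (26) → `Step4_Cor126_250` (250) → `Step5_final`;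
`claim_of_steps : Step4_Cor126_250 → Step5_final → ClaimedTheorem`, `clay_of_claimed` PROVED). Cell
ns-claims (D-0090): refuter-8 g2 (locator two-sourced with refuter-1 g0, whose ℓ¹/ℓ² cube scratch
e90783ac08021559 is adapted below with credit; three-sourced with the typist's ordered index); referee
ref-1 g3; salvage-p6 (filer, conv. (b)).

FIRST FAILING STEP. Theorem 4.2 p.10, displays (24)–(25), printed proof p.11 l.1–9: «The tangential active
region has ≲ R^{5/4} points, while each fibre in the longitudinal variable has length ≲ R^{3/4}. Two
applications of Cauchy–Schwarz therefore give (Σ_q F_{j,τ}(q,t))² ≲ R^{5/4}·R^{3/4}‖a_{j,τ}(t)‖²_{L²} =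
R²‖a_{j,τ}(t)‖²_{L²}. … Summing over the finitely overlapping direction classes and using (23) yields (26).»
The direction classes are a FIXED finite family (p.9 l.107 «finitely many direction classes τ»; §6.1 p.19
«Fix once and for all the same finite family of primitive direction classes τ used in Section 4»), so one
class carries `≳ R^{9/4}/#T` of the `≍ c_*³R^{9/4}` low lattice points `|p| ≤ c_*R^{3/4}` (a tangential
section of the low ball has `≍ R^{3/2}` points, not `R^{5/4}`); the ℓ¹ → ℓ² conversion therefore costs
`R^{9/4}`, which is the text's own Proposition 4.1 p.9 («one only has the crude estimate ‖Γ_j(t)‖_{ℓ¹} ≲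
R_j^{9/4}‖a_j(t)‖²_{L²} … so a raw bound of the form R_j^{1/4}‖u₀‖²_{L²} is false in general»), not the
`R²` of (25). Both typed faces are refuted by integer-cube indicators:
* `not_Step2L_Thm42_25a` — the literal face `(Σ_{|p| ≤ c_*R^{3/4}} |â(p)|)² ≤ C R² Σ|â(p)|²` (25a);
* `not_Step2_Thm42_2425` — the reading-robust chain face (p.10 last display ≤ C R²‖a‖²‖v‖², i.e. what
  (24)–(25) and p.11 l.9 deliver to (26)), killed by a cube low block against a translated-cube shell block:
  the ratio is `≍ R^{1/4}`.
Consumption in print (why this is on the route to Theorem 1.2): (26) = `Step3_Thm42_26` is fed by (24)–(25)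
(p.11 l.9); (26) enters Theorem 7.3 (141) (p.38: «the contributions of C_{η,j}, R^{lo,4}_j, E^{sub,6}_j
are (26), (32), (45)»), the same compression is re-invoked for (31) p.12 and on p.16 («compressing the low
pair exactly as in the proof of Theorem 4.2»); Thm 7.3 → Thm 7.4 (151) → Lemma 12.1 (237) → Thm 12.5 /
Cor 12.6 (250) = `Step4_Cor126_250`, the hypothesis `claim_of_steps` consumes. `Step1_Thm42_23` ((23),
no small divisor: Ω₁ ≥ ν|k|² by (15)) is not contested here.

WHAT THIS IS NOT: not a claim about NS regularity or blow-up; not a proof or refutation of (26), (141) or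
(250) themselves; not a claim about any author beyond the typed locator.
-/

set_option linter.dupNamespace false

open Finset Literature.Analysis.FunctionSpaces

namespace Summit.NavierStokesRegularity.NavierStokesRegularity.Theorems.AbuGhuwaleh2026b

open Literature.Claims.NS.AbuGhuwaleh2026b

/-! ## Lattice cubes, translated cubes, indicators -/

/-- The integer cube `{p : |pᵢ| ≤ m}` (refuter-1 g0's test family). -/
noncomputable def cube (m : ℕ) : Finset Z3 := Fintype.piFinset fun _ => Finset.Icc (-(m : ℤ)) m

/-- The cube has `(2m+1)³` lattice points. -/
theorem card_cube (m : ℕ) : (cube m).card = (2 * m + 1) ^ 3 := by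
  rw [cube, Fintype.card_piFinset, Finset.prod_const, Finset.card_univ, Fintype.card_fin,
    Int.card_Icc]
  congr 1
  omega

/-- Membership in the cube, coordinatewise. -/
theorem mem_cube_iff {m : ℕ} {p : Z3} : p ∈ cube m ↔ ∀ i, -(m : ℤ) ≤ p i ∧ p i ≤ m := by
  simp [cube, Fintype.mem_piFinset, Finset.mem_Icc]

/-- Cubes are nested. -/
theorem cube_mono {m m' : ℕ} (h : m ≤ m') : cube m ⊆ cube m' := by
  intro p hp
  rw [mem_cube_iff] at hp ⊢
  intro i
  have := hp i
  constructor <;> omega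

/-- Each coordinate of a cube point has square `≤ m²`. -/
theorem sq_le_of_mem_cube {m : ℕ} {p : Z3} (hp : p ∈ cube m) (i : Fin 3) :
    ((p i : ℝ)) ^ 2 ≤ (m : ℝ) ^ 2 := by
  have h := (mem_cube_iff.mp hp) i
  have h1 : |(p i : ℝ)| ≤ (m : ℝ) := by
    rw [abs_le]; constructor <;> exact_mod_cast (by omega : _)
  calc ((p i : ℝ)) ^ 2 = |(p i : ℝ)| ^ 2 := (sq_abs _).symm
    _ ≤ (m : ℝ) ^ 2 := pow_le_pow_left₀ (abs_nonneg _) h1 2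

/-- `lnorm p ≤ L` whenever `p ∈ cube m` and `3 m² ≤ L²`, `0 ≤ L`. -/
theorem lnorm_le_of_mem_cube {m : ℕ} {p : Z3} (hp : p ∈ cube m) {L : ℝ} (hL : 0 ≤ L)
    (h3 : 3 * (m : ℝ) ^ 2 ≤ L ^ 2) : lnorm p ≤ L := by
  have hsum : Torus.freqNormSq p ≤ 3 * (m : ℝ) ^ 2 := by
    unfold Torus.freqNormSq
    calc ∑ i, ((p i : ℝ)) ^ 2 ≤ ∑ _i : Fin 3, (m : ℝ) ^ 2 :=
          Finset.sum_le_sum fun i _ => sq_le_of_mem_cube hp i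
      _ = 3 * (m : ℝ) ^ 2 := by simp
  unfold lnorm
  calc Real.sqrt (Torus.freqNormSq p) ≤ Real.sqrt (L ^ 2) := Real.sqrt_le_sqrt (hsum.trans h3)
    _ = L := Real.sqrt_sq hL

/-- `(t⁴)^{3/4} = t³` for `t ≥ 0`. -/
theorem rpow_four_three_quarters {t : ℝ} (ht : 0 ≤ t) : (t ^ 4) ^ (3 / 4 : ℝ) = t ^ 3 := by
  rw [show t ^ 4 = t ^ (4 : ℝ) by norm_cast, ← Real.rpow_mul ht,
    show (4 : ℝ) * (3 / 4) = (3 : ℕ) by norm_num, Real.rpow_natCast]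

/-- Translate of a cube by `k₀`. -/
noncomputable def tcube (k₀ : Z3) (m : ℕ) : Finset Z3 := (cube m).image fun e => k₀ + e

/-- A translated cube has `(2m+1)³` lattice points. -/
theorem card_tcube (k₀ : Z3) (m : ℕ) : (tcube k₀ m).card = (2 * m + 1) ^ 3 := by
  rw [tcube, Finset.card_image_of_injective _ (add_right_injective k₀), card_cube]

/-- Membership in a translated cube. -/
theorem mem_tcube_iff {k₀ : Z3} {m : ℕ} {k : Z3} : k ∈ tcube k₀ m ↔ k - k₀ ∈ cube m := by
  rw [tcube, Finset.mem_image]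
  constructor
  · rintro ⟨e, he, rfl⟩
    simpa using he
  · intro h
    exact ⟨k - k₀, h, by abel⟩

/-- Translated cubes with a common centre are nested. -/
theorem tcube_mono (k₀ : Z3) {m m' : ℕ} (h : m ≤ m') : tcube k₀ m ⊆ tcube k₀ m' := by
  intro k hk
  rw [mem_tcube_iff] at hk ⊢
  exact cube_mono h hk

/-- Indicator of a finite set of modes. -/
noncomputable def ind (K : Finset Z3) : Z3 → ℝ := fun k => if k ∈ K then 1 else 0

/-- The indicator is `1` on the set. -/
theorem ind_of_mem {K : Finset Z3} {k : Z3} (h : k ∈ K) : ind K k = 1 := by simp [ind, h]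

/-- The indicator is `0` off the set. -/
theorem ind_of_not_mem {K : Finset Z3} {k : Z3} (h : k ∉ K) : ind K k = 0 := by simp [ind, h]

/-- The shell-block centre `k₀ = (t⁴ + 3m, 0, 0)`. -/
def kzero (t m : ℕ) : Z3 := fun i => if i = 0 then (t : ℤ) ^ 4 + 3 * m else 0

/-- First coordinate of the shell-block centre. -/
@[simp] theorem kzero_zero (t m : ℕ) : kzero t m 0 = (t : ℤ) ^ 4 + 3 * m := by simp [kzero]
/-- Second coordinate of the shell-block centre. -/
@[simp] theorem kzero_one (t m : ℕ) : kzero t m 1 = 0 := by simp [kzero]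
/-- Third coordinate of the shell-block centre. -/
@[simp] theorem kzero_two (t m : ℕ) : kzero t m 2 = 0 := by simp [kzero]

/-! ## The parameters `R = t⁴`, `m = ⌊t³/√3⌋` -/

/-- For every alleged constant `C` there are `t ≥ 7` and `m` with `81√3·C < t`, `√3·m ≤ t³ < √3·(m+1)`,
`7m ≤ t⁴` (take `t = ⌈81√3·C⌉ + 7`, `m = ⌊t³/√3⌋`). -/
theorem params (C : ℝ) : ∃ t m : ℕ, (1 : ℝ) ≤ (t : ℝ) ^ 4 ∧ 81 * Real.sqrt 3 * C < t ∧
    Real.sqrt 3 * (m : ℝ) ≤ (t : ℝ) ^ 3 ∧ (t : ℝ) ^ 3 / Real.sqrt 3 < (m : ℝ) + 1 ∧ 7 * (m : ℝ) ≤ (t : ℝ) ^ 4 := by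
  have hs3 : 0 < Real.sqrt 3 := Real.sqrt_pos.mpr (by norm_num)
  have hs3' : (1 : ℝ) ≤ Real.sqrt 3 := by
    rw [show (1 : ℝ) = Real.sqrt 1 by simp]
    exact Real.sqrt_le_sqrt (by norm_num)
  set t : ℕ := ⌈81 * Real.sqrt 3 * C⌉₊ + 7 with ht_def
  have ht7 : (7 : ℝ) ≤ t := by
    have : 7 ≤ t := by omega
    exact_mod_cast this
  set L : ℝ := (t : ℝ) ^ 3 / Real.sqrt 3 with hL_def
  have hL0 : 0 ≤ L := by positivity
  set m : ℕ := ⌊L⌋₊ with hm_def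
  have hmL : (m : ℝ) ≤ L := Nat.floor_le hL0
  refine ⟨t, m, one_le_pow₀ (by linarith), ?_, ?_, Nat.lt_floor_add_one L, ?_⟩
  · have h1 : 81 * Real.sqrt 3 * C ≤ ⌈81 * Real.sqrt 3 * C⌉₊ := Nat.le_ceil _
    have h2 : (⌈81 * Real.sqrt 3 * C⌉₊ : ℝ) + 7 = t := by rw [ht_def]; push_cast; ring
    linarith
  · have := (le_div_iff₀ hs3).mp hmL
    linarith
  · have hm3 : (m : ℝ) ≤ (t : ℝ) ^ 3 := hmL.trans (div_le_self (by positivity) hs3')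
    calc 7 * (m : ℝ) ≤ 7 * (t : ℝ) ^ 3 := by linarith
      _ ≤ t * (t : ℝ) ^ 3 := by gcongr
      _ = (t : ℝ) ^ 4 := by ring

/-- The low cube lies in the ball `|p| ≤ 1·(t⁴)^{3/4} = t³` once `√3 m ≤ t³`. -/
theorem low_bounds {t m : ℕ} (hm : Real.sqrt 3 * (m : ℝ) ≤ (t : ℝ) ^ 3) {p : Z3} (hp : p ∈ cube m) :
    lnorm p ≤ 1 * ((t : ℝ) ^ 4) ^ (3 / 4 : ℝ) := by
  rw [rpow_four_three_quarters (Nat.cast_nonneg _), one_mul]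
  refine lnorm_le_of_mem_cube hp (by positivity) ?_
  have h0 : 0 ≤ Real.sqrt 3 * (m : ℝ) := by positivity
  have h2 : (Real.sqrt 3 * (m : ℝ)) ^ 2 ≤ ((t : ℝ) ^ 3) ^ 2 := pow_le_pow_left₀ h0 hm 2
  have h3 : (Real.sqrt 3 * (m : ℝ)) ^ 2 = 3 * (m : ℝ) ^ 2 := by
    rw [mul_pow, Real.sq_sqrt (by norm_num : (0 : ℝ) ≤ 3)]
  linarith

/-- The shell block `k₀ + cube(3m)` lies in the annulus `t⁴ ≤ |k| ≤ 2t⁴` once `7m ≤ t⁴`. -/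
theorem shell_bounds {t m : ℕ} (hmX : 7 * (m : ℝ) ≤ (t : ℝ) ^ 4) {k : Z3}
    (hk : k ∈ tcube (kzero t m) (3 * m)) : (t : ℝ) ^ 4 ≤ lnorm k ∧ lnorm k ≤ 2 * (t : ℝ) ^ 4 := by
  rw [mem_tcube_iff, mem_cube_iff] at hk
  have h0 := hk 0
  have h1 := hk 1
  have h2 := hk 2
  simp only [Pi.sub_apply, kzero_zero, kzero_one, kzero_two, sub_zero] at h0 h1 h2
  push_cast at h0 h1 h2
  have e0lo : ((t : ℝ)) ^ 4 ≤ (k 0 : ℝ) := by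
    have : (t : ℤ) ^ 4 ≤ k 0 := by omega
    exact_mod_cast this
  have e0hi : (k 0 : ℝ) ≤ (t : ℝ) ^ 4 + 6 * m := by
    have : k 0 ≤ (t : ℤ) ^ 4 + 6 * m := by omega
    exact_mod_cast this
  have e1lo : -(3 * (m : ℝ)) ≤ (k 1 : ℝ) := by exact_mod_cast h1.1
  have e1hi : (k 1 : ℝ) ≤ 3 * (m : ℝ) := by exact_mod_cast h1.2
  have e2lo : -(3 * (m : ℝ)) ≤ (k 2 : ℝ) := by exact_mod_cast h2.1
  have e2hi : (k 2 : ℝ) ≤ 3 * (m : ℝ) := by exact_mod_cast h2.2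
  have hS : Torus.freqNormSq k = (k 0 : ℝ) ^ 2 + (k 1 : ℝ) ^ 2 + (k 2 : ℝ) ^ 2 := by
    simp [Torus.freqNormSq, Fin.sum_univ_three]
  have ht4 : (0 : ℝ) ≤ (t : ℝ) ^ 4 := by positivity
  have hm0 : (0 : ℝ) ≤ m := Nat.cast_nonneg _
  unfold lnorm
  rw [hS]
  constructor
  · apply (Real.le_sqrt ht4 (by positivity)).mpr
    nlinarith
  · have hsq1 : (k 1 : ℝ) ^ 2 ≤ (3 * (m : ℝ)) ^ 2 := by nlinarith
    have hsq2 : (k 2 : ℝ) ^ 2 ≤ (3 * (m : ℝ)) ^ 2 := by nlinarith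
    have hsq0 : (k 0 : ℝ) ^ 2 ≤ ((t : ℝ) ^ 4 + 6 * m) ^ 2 := by nlinarith
    have hmain : ((t : ℝ) ^ 4 + 6 * m) ^ 2 + 2 * (3 * (m : ℝ)) ^ 2 ≤ (2 * (t : ℝ) ^ 4) ^ 2 := by
      nlinarith [mul_nonneg ht4 (by linarith : (0 : ℝ) ≤ (t : ℝ) ^ 4 - 7 * m),
        mul_nonneg hm0 (by linarith : (0 : ℝ) ≤ (t : ℝ) ^ 4 - 7 * m)]
    calc Real.sqrt ((k 0 : ℝ) ^ 2 + (k 1 : ℝ) ^ 2 + (k 2 : ℝ) ^ 2)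
        ≤ Real.sqrt ((2 * (t : ℝ) ^ 4) ^ 2) := Real.sqrt_le_sqrt (by linarith)
      _ = 2 * (t : ℝ) ^ 4 := Real.sqrt_sq (by positivity)

/-! ## Evaluations on the test data -/

/-- `‖a‖²_{ℓ²} = (2m+1)³` for the flat array `a ≡ 1` on the cube. -/
theorem sum_sq_one_cube (m : ℕ) : (∑ p ∈ cube m, (fun _ : Z3 => (1 : ℝ)) p ^ 2) = (2 * (m : ℝ) + 1) ^ 3 := by
  simp only [one_pow, Finset.sum_const, nsmul_eq_mul, mul_one, card_cube]
  push_cast; ring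

/-- `‖a‖_{ℓ¹} = (2m+1)³` for the flat array `a ≡ 1` on the cube. -/
theorem sum_abs_one_cube (m : ℕ) : (∑ p ∈ cube m, |(fun _ : Z3 => (1 : ℝ)) p|) = (2 * (m : ℝ) + 1) ^ 3 := by
  simp only [abs_one, Finset.sum_const, nsmul_eq_mul, mul_one, card_cube]
  push_cast; ring

/-- `‖v‖²_{ℓ²} = (2n+1)³` for the indicator `v` of a translated cube. -/
theorem sum_sq_ind_tcube (k₀ : Z3) (n : ℕ) :
    (∑ k ∈ tcube k₀ n, ind (tcube k₀ n) k ^ 2) = (2 * (n : ℝ) + 1) ^ 3 := by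
  rw [Finset.sum_congr rfl fun k hk => by rw [ind_of_mem hk]]
  simp only [one_pow, Finset.sum_const, nsmul_eq_mul, mul_one, card_tcube]
  push_cast; ring

/-- Lower bound: every triple `(k, p, p′)` with `k ∈ k₀ + cube m`, `p, p′ ∈ cube m` contributes `1`,
because then `k − (p − p′) ∈ k₀ + cube(3m)`. -/
theorem absSum_lower (k₀ : Z3) (m : ℕ) :
    (2 * (m : ℝ) + 1) ^ 3 * ((2 * (m : ℝ) + 1) ^ 3 * (2 * (m : ℝ) + 1) ^ 3)
      ≤ absSum (cube m) (tcube k₀ (3 * m)) (fun _ => 1) (ind (tcube k₀ (3 * m))) := by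
  have hsub : tcube k₀ m ⊆ tcube k₀ (3 * m) := tcube_mono k₀ (by omega)
  have hinner : ∀ k ∈ tcube k₀ m,
      (∑ p ∈ cube m, ∑ p' ∈ cube m, |(fun _ : Z3 => (1 : ℝ)) p| * |(fun _ : Z3 => (1 : ℝ)) p'|
        * |ind (tcube k₀ (3 * m)) k| * |ind (tcube k₀ (3 * m)) (k - (p - p'))|)
      = (2 * (m : ℝ) + 1) ^ 3 * (2 * (m : ℝ) + 1) ^ 3 := by
    intro k hk
    have hkK : k ∈ tcube k₀ (3 * m) := hsub hk
    have hterm : ∀ p ∈ cube m, ∀ p' ∈ cube m, |(fun _ : Z3 => (1 : ℝ)) p| * |(fun _ : Z3 => (1 : ℝ)) p'|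
        * |ind (tcube k₀ (3 * m)) k| * |ind (tcube k₀ (3 * m)) (k - (p - p'))| = 1 := by
      intro p hp p' hp'
      have hmem : k - (p - p') ∈ tcube k₀ (3 * m) := by
        rw [mem_tcube_iff, mem_cube_iff]
        rw [mem_tcube_iff, mem_cube_iff] at hk
        rw [mem_cube_iff] at hp hp'
        intro i
        have h1 := hk i
        have h2 := hp i
        have h3 := hp' i
        simp only [Pi.sub_apply] at h1 ⊢
        constructor <;> push_cast <;> omega
      rw [ind_of_mem hkK, ind_of_mem hmem]
      simp
    rw [Finset.sum_congr rfl fun p hp => Finset.sum_congr rfl fun p' hp' => hterm p hp p' hp']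
    simp only [Finset.sum_const, nsmul_eq_mul, mul_one, card_cube]
    push_cast; ring
  unfold absSum
  calc (2 * (m : ℝ) + 1) ^ 3 * ((2 * (m : ℝ) + 1) ^ 3 * (2 * (m : ℝ) + 1) ^ 3)
      = ∑ k ∈ tcube k₀ m, (∑ p ∈ cube m, ∑ p' ∈ cube m,
          |(fun _ : Z3 => (1 : ℝ)) p| * |(fun _ : Z3 => (1 : ℝ)) p'|
            * |ind (tcube k₀ (3 * m)) k| * |ind (tcube k₀ (3 * m)) (k - (p - p'))|) := by
        rw [Finset.sum_congr rfl hinner]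
        simp only [Finset.sum_const, nsmul_eq_mul, card_tcube]
        push_cast; ring
    _ ≤ _ := by
        apply Finset.sum_le_sum_of_subset_of_nonneg hsub
        intro k _ _
        apply Finset.sum_nonneg; intro p _
        apply Finset.sum_nonneg; intro p' _
        exact mul_nonneg (mul_nonneg (mul_nonneg (abs_nonneg _) (abs_nonneg _)) (abs_nonneg _))
          (abs_nonneg _)

/-- The final arithmetic: `(2m+1)³ ≤ 27·C·t⁸` with `2m+1 > t³/√3` forces `t < 81√3·C`. -/
theorem arith_core {C : ℝ} {t m : ℕ} (htC : 81 * Real.sqrt 3 * C < t)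
    (hmL' : (t : ℝ) ^ 3 / Real.sqrt 3 < (m : ℝ) + 1) (key : (2 * (m : ℝ) + 1) ^ 3 ≤ 27 * C * (t : ℝ) ^ 8) :
    False := by
  have hs3 : 0 < Real.sqrt 3 := Real.sqrt_pos.mpr (by norm_num)
  set L : ℝ := (t : ℝ) ^ 3 / Real.sqrt 3 with hL_def
  have hL0 : 0 ≤ L := by positivity
  have h2m : L < 2 * (m : ℝ) + 1 := by
    have : (0 : ℝ) ≤ m := Nat.cast_nonneg _
    linarith
  have hcube : L ^ 3 < (2 * (m : ℝ) + 1) ^ 3 := pow_lt_pow_left₀ h2m hL0 (by norm_num)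
  have hL3 : L ^ 3 = (t : ℝ) ^ 9 / (3 * Real.sqrt 3) := by
    rw [hL_def, div_pow]
    have : Real.sqrt 3 ^ 3 = 3 * Real.sqrt 3 := by
      rw [pow_succ, Real.sq_sqrt (by norm_num : (0 : ℝ) ≤ 3)]
    rw [this]; ring
  have hfin : (t : ℝ) ^ 9 < 81 * Real.sqrt 3 * C * (t : ℝ) ^ 8 := by
    have h1 : (t : ℝ) ^ 9 / (3 * Real.sqrt 3) < 27 * C * (t : ℝ) ^ 8 := by
      rw [← hL3]; linarith
    rw [div_lt_iff₀ (by positivity)] at h1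
    linarith
  have ht8 : (0 : ℝ) ≤ (t : ℝ) ^ 8 := by positivity
  have : (t : ℝ) < 81 * Real.sqrt 3 * C := by
    have h1 : (t : ℝ) * (t : ℝ) ^ 8 < (81 * Real.sqrt 3 * C) * (t : ℝ) ^ 8 := by
      calc (t : ℝ) * (t : ℝ) ^ 8 = (t : ℝ) ^ 9 := by ring
        _ < _ := hfin
    exact lt_of_mul_lt_mul_right h1 ht8
  linarith

/-! ## The two kills -/

/-- **C61b kill, literal face — Theorem 4.2 (25) first half, p.10; printed proof p.11 l.1–6**
(«The tangential active region has ≲ R^{5/4} points, while each fibre in the longitudinal variable has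
length ≲ R^{3/4}. Two applications of Cauchy–Schwarz therefore give (Σ_q F_{j,τ}(q,t))² ≲
R^{5/4}·R^{3/4}‖a_{j,τ}(t)‖² = R²‖a_{j,τ}(t)‖²»): in the literal p.9 reading `Σ_{(r,s)}Γ^{tan}_{j,τ} =
(Σ_p |â_j(p)|)²`, and the low block `|p| ≤ c_* R^{3/4}` holds `≍ c_*³ R^{9/4}` lattice points, so the
indicator of the integer cube of side `m = ⌊R^{3/4}/√3⌋` has `(Σ|â|)²/Σ|â|² = (2m+1)³ ≍ R^{9/4}`, not `≲ R²` —
the text's own Proposition 4.1 p.9 exponent. Countermodel at `c_* = 1`, `R = t⁴`, `t = ⌈81√3·C⌉ + 7`.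
(Cube core of refuter-1 g0's scratch e90783ac08021559, adapted to the `lnorm` hypothesis.)
[cite: AbuGhuwaleh2026b, Thm 4.2 (25) p.10; proof p.11 l.1–6; Prop 4.1 p.9] -/
theorem not_Step2L_Thm42_25a : ¬ Literature.Claims.NS.AbuGhuwaleh2026b.Step2L_Thm42_25a := by
  intro h
  obtain ⟨C, hC⟩ := h 1 one_pos le_rfl
  obtain ⟨t, m, ht1, htC, hm1, hmL', -⟩ := params C
  have key := hC ((t : ℝ) ^ 4) ht1 (cube m) (fun _ => 1) (fun p hp => low_bounds hm1 hp)
  rw [sum_abs_one_cube, sum_sq_one_cube] at key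
  -- key : ((2m+1)³)² ≤ C (t⁴)² (2m+1)³
  have hN : (0 : ℝ) < (2 * (m : ℝ) + 1) ^ 3 := by positivity
  have key2 : (2 * (m : ℝ) + 1) ^ 3 ≤ C * (t : ℝ) ^ 8 := by
    have h' : (2 * (m : ℝ) + 1) ^ 3 * (2 * (m : ℝ) + 1) ^ 3 ≤ (C * (t : ℝ) ^ 8) * (2 * (m : ℝ) + 1) ^ 3 := by
      calc _ = ((2 * (m : ℝ) + 1) ^ 3) ^ 2 := by ring
        _ ≤ C * ((t : ℝ) ^ 4) ^ 2 * (2 * (m : ℝ) + 1) ^ 3 := key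
        _ = _ := by ring
    exact le_of_mul_le_mul_right h' hN
  have hC0 : 0 ≤ C * (t : ℝ) ^ 8 := hN.le.trans key2
  exact arith_core htC hmL' (by nlinarith)

/-- **C61b kill, chain face — Theorem 4.2 p.10 last display → (24) → (25) → p.11 l.9** («Summing over
the finitely overlapping direction classes and using (23) yields (26)»): the absolute quadrilinear sum
`Σ_{k,p,p′} |â(p)||â(p′)||v̂(k)||v̂(k−(p−p′))|` over the low block `|p|,|p′| ≤ c_*R^{3/4}` and a shell
`R ≤ |k| ≤ 2R` is NOT `≤ C R² ‖a‖²_{ℓ²} ‖v‖²_{ℓ²}` with `C` independent of `R`. Countermodel (`c_* = 1`,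
`R = t⁴`, `m = ⌊t³/√3⌋`, `t = ⌈81√3·C⌉ + 7`): `A = cube m`, `a ≡ 1`, `K = k₀ + cube(3m)` with
`k₀ = (t⁴ + 3m, 0, 0)`, `v = 𝟙_K`; every triple with `k ∈ k₀ + cube m` contributes `1` (then
`k − (p − p′) ∈ K`), so `absSum ≥ (2m+1)⁹`, while the right side is `C t⁸ (2m+1)³ (6m+1)³ ≤ 27 C t⁸ (2m+1)⁶`;
with `2m+1 > t³/√3` this forces `t < 81√3·C`. The ratio grows like `R^{1/4}` — exactly the gap between
(25) and Proposition 4.1 p.9; the «thin direction classes» bookkeeping dies too (cross-class pairs `(p,p′)`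
are present in the p.10 display). [cite: AbuGhuwaleh2026b, Thm 4.2 (24)–(25) p.10; proof p.11 l.1–9] -/
theorem not_Step2_Thm42_2425 : ¬ Literature.Claims.NS.AbuGhuwaleh2026b.Step2_Thm42_2425 := by
  intro h
  obtain ⟨C, hC⟩ := h 1 one_pos le_rfl
  obtain ⟨t, m, ht1, htC, hm1, hmL', hmX⟩ := params C
  have key := hC ((t : ℝ) ^ 4) ht1 (cube m) (tcube (kzero t m) (3 * m)) (fun _ => 1)
    (ind (tcube (kzero t m) (3 * m))) (fun p hp => low_bounds hm1 hp) (fun k hk => shell_bounds hmX hk)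
    (fun k hk => ind_of_not_mem hk)
  rw [sum_sq_one_cube, sum_sq_ind_tcube] at key
  push_cast at key
  have low := absSum_lower (kzero t m) m
  set N : ℝ := (2 * (m : ℝ) + 1) ^ 3 with hN_def
  have hN : 0 < N := by positivity
  have h27 : (2 * ((3 : ℝ) * m) + 1) ^ 3 ≤ 27 * N := by
    have : (2 * ((3 : ℝ) * m) + 1) ≤ 3 * (2 * (m : ℝ) + 1) := by linarith
    calc (2 * ((3 : ℝ) * m) + 1) ^ 3 ≤ (3 * (2 * (m : ℝ) + 1)) ^ 3 := pow_le_pow_left₀ (by positivity) this 3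
      _ = 27 * N := by rw [hN_def]; ring
  -- low.trans key : N·(N·N) ≤ C (t⁴)² N (6m+1)³
  have key2 : N * N ≤ C * ((t : ℝ) ^ 4) ^ 2 * (2 * ((3 : ℝ) * m) + 1) ^ 3 := by
    have h' : N * (N * N) ≤ N * (C * ((t : ℝ) ^ 4) ^ 2 * (2 * ((3 : ℝ) * m) + 1) ^ 3) := by
      calc N * (N * N) ≤ C * ((t : ℝ) ^ 4) ^ 2 * N * (2 * ((3 : ℝ) * m) + 1) ^ 3 := low.trans key
        _ = _ := by ring
    exact le_of_mul_le_mul_left h' hN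
  have hCtt : 0 ≤ C * ((t : ℝ) ^ 4) ^ 2 := by
    by_contra hneg
    push Not at hneg
    have h1 : C * ((t : ℝ) ^ 4) ^ 2 * (2 * ((3 : ℝ) * m) + 1) ^ 3 ≤ 0 :=
      mul_nonpos_of_nonpos_of_nonneg hneg.le (by positivity)
    nlinarith [mul_pos hN hN]
  have key3 : N ≤ 27 * C * (t : ℝ) ^ 8 := by
    have h2 : N * N ≤ (27 * C * (t : ℝ) ^ 8) * N := by
      calc N * N ≤ C * ((t : ℝ) ^ 4) ^ 2 * (27 * N) := key2.trans (mul_le_mul_of_nonneg_left h27 hCtt)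
        _ = (27 * C * (t : ℝ) ^ 8) * N := by ring
    exact le_of_mul_le_mul_right h2 hN
  exact arith_core htC hmL' key3

end Summit.NavierStokesRegularity.NavierStokesRegularity.Theorems.AbuGhuwaleh2026b
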